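import Literature.Topology.FourManifolds.RegularSlabCobordism
import HarnessLib

/-!
# Regular slabs: smoothness, critical points and Hessians of ambient functions read on the slab

Topic `Literature/Topology/FourManifolds` (fact seat
`provefact-Literature.Topology.FourManifolds.exists-68ee520c9a`, Wall 1964, Lemma 2,
`WallBoundingHandlebody.lean`; item 6 of the route recorded there, the splicing on `W` of a
function given on the slab `K = W − D̊⁵`).  Everything here is **proved**; no named facts.

For a regular slab `K = g⁻¹[a, b]` of a Morse function on a cobordism (Milnor 1965, Lemma 2.9;
the tree's `RegularSlab`, `RegularSlabCobordism.lean`) and a real function `F` on the ambient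
`W`:

* `RegularSlab.contMDiffAt_of_comp_incl` — at a point of the OPEN slab `a < g < b`, `F` is
  smooth at `incl p` as soon as `F ∘ incl` is smooth at `p` (there the half-slice chart of `K`
  is the extended chart of `W`);
* `RegularSlab.isMCriticalPt_comp_incl_iff` — for smooth `F`, `p` is critical for `F ∘ incl`
  iff `incl p` is critical for `F` (every point; the differential of the restriction is read in
  a half-slice chart where `d(Θ⁻¹)` is onto) — the tree's `RegularSlab.isMCriticalPt_fn_iff` for
  a general ambient function;
* `RegularSlab.mhessian_comp_incl_eq`, `RegularSlab.morseIndex_comp_incl_eq` — at a point of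
  the open slab the Hessians, hence the Morse indices, of `F ∘ incl` and `F` agree.

## References

* J. Milnor, *Lectures on the h-cobordism theorem* (1965), Lemma 2.9 (PDF p. 11). [MilnorHCobordism1965]
* C. T. C. Wall, *On simply-connected 4-manifolds*, J. London Math. Soc. 39 (1964), proof of
  Lemma 2 (p. 144). [WallJLMS1964]
-/

open scoped Manifold ContDiff Topology
open Set Function Filter

noncomputable section

universe u

namespace Literature.Topology.FourManifolds

/-- Local notation: `𝔼 n` is the model Euclidean space `EuclideanSpace ℝ (Fin n)`. -/
local notation "𝔼 " n:arg => EuclideanSpace ℝ (Fin n)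

section Transfer

variable {n : ℕ} {M N : Type u} [TopologicalSpace M] [ChartedSpace (𝔼 n) M]
  [TopologicalSpace N] [ChartedSpace (𝔼 n) N]

namespace RegularSlab

variable {c : Cobordism n M N} {g : c.W → ℝ} {a b : ℝ} (h : c.IsRegularSlab g a b)

/-- **Smoothness off the slab's boundary transfers to the ambient manifold**: at a point of the
open slab `a < g < b`, an ambient function `F` with `F ∘ incl` smooth at `p` is smooth at
`incl p` (the half-slice chart of the slab at `p` is the extended chart of `W` at `incl p`,
whose model image is interior, so "within the half-space" is no restriction).
[cite: MilnorHCobordism1965, Lemma 2.9 (PDF p. 11)] -/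
theorem contMDiffAt_of_comp_incl {F : c.W → ℝ} (p : RegularSlab h) (hp : g (incl h p) ∈ Ioo a b)
    (hF : ContMDiffAt (𝓡∂ (n + 1)) 𝓘(ℝ, ℝ) ∞ (F ∘ incl h) p) :
    ContMDiffAt (𝓡∂ (n + 1)) 𝓘(ℝ, ℝ) ∞ F (incl h p) := by
  set D := h.atlas.datum p with hDd
  have hD := atlas_datum_Θ_eq_of_mem_Ioo h p hp
  have hint : (𝓡∂ (n + 1)).IsInteriorPoint (incl h p) := h.isInteriorPoint_of_mem p.2
  have h0 : 0 < D.Θ p.1 0 := by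
    rw [hDd, hD, sublevelChartLT_apply]
    rw [ModelWithCorners.IsInteriorPoint, interior_range_modelWithCornersEuclideanHalfSpace] at hint
    exact hint
  -- `F ∘ incl` read in the preferred extended chart at `p` is smooth within the half-space at `Θ p`
  have h1 := (contMDiffAt_iff.1 hF).2
  have hx : extChartAt (𝓡∂ (n + 1)) p p = D.Θ p.1 := h.atlas.extChartAt_self_apply p
  rw [hx] at h1
  simp only [extChartAt_model_space_eq_id, PartialEquiv.refl_coe, CompTriple.comp_eq] at h1
  -- the half-space is a neighbourhood of `Θ p`, and the written function is `F ∘ Θ.symm` near it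
  have hnhds : range (𝓡∂ (n + 1)) ∈ 𝓝 (D.Θ p.1) :=
    mem_interior_iff_mem_nhds.1 (by
      rw [interior_range_modelWithCornersEuclideanHalfSpace]; exact h0)
  have h2 : ContDiffAt ℝ ∞ ((F ∘ incl h) ∘ (extChartAt (𝓡∂ (n + 1)) p).symm) (D.Θ p.1) :=
    h1.contDiffAt hnhds
  have hz₀ : D.Θ p.1 ∈ D.Θ.target := D.Θ.map_source (h.atlas.mem_source p)
  have heq : ((F ∘ incl h) ∘ (extChartAt (𝓡∂ (n + 1)) p).symm) =ᶠ[𝓝 (D.Θ p.1)] (F ∘ D.Θ.symm) := by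
    have hev0 : ∀ᶠ z in 𝓝 (D.Θ p.1), 0 ≤ z 0 := by
      filter_upwards [hnhds] with z hz
      rw [range_modelWithCornersEuclideanHalfSpace] at hz
      exact hz
    have hevt : ∀ᶠ z in 𝓝 (D.Θ p.1), z ∈ D.Θ.target := D.Θ.open_target.mem_nhds hz₀
    filter_upwards [hev0, hevt] with z hz0 hzt
    show F (incl h ((((h.atlas.datum p).chart p).extend (𝓡∂ (n + 1))).symm z)) = F (D.Θ.symm z)
    congr 1
    exact (h.atlas.datum p).coe_extend_chart_symm_of_mem hz0 hzt
  have h3 : ContDiffAt ℝ ∞ (F ∘ D.Θ.symm) (D.Θ p.1) := h2.congr_of_eventuallyEq heq.symm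
  -- compose with the (smooth) chart `Θ` of `W`
  have hΘ : ContMDiffAt (𝓡∂ (n + 1)) 𝓘(ℝ, 𝔼 (n + 1)) ∞ D.Θ (incl h p) :=
    (D.contMDiffOn_toFun _ (h.atlas.mem_source p)).contMDiffAt
      (D.Θ.open_source.mem_nhds (h.atlas.mem_source p))
  have h4 : ContMDiffAt (𝓡∂ (n + 1)) 𝓘(ℝ, ℝ) ∞ ((F ∘ D.Θ.symm) ∘ D.Θ) (incl h p) :=
    h3.contMDiffAt.comp (incl h p) hΘ
  refine h4.congr_of_eventuallyEq ?_
  filter_upwards [D.Θ.open_source.mem_nhds (h.atlas.mem_source p)] with z hz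
  simp only [comp_apply, D.Θ.left_inv hz]

/-- **Critical points of the restriction of an ambient function are those of the function**
(every point of the slab, boundary included). [cite: MilnorHCobordism1965, Lemma 2.9 (PDF p. 11)] -/
theorem isMCriticalPt_comp_incl_iff (hn : 1 ≤ n) {F : c.W → ℝ}
    (hF : ContMDiff (𝓡∂ (n + 1)) 𝓘(ℝ, ℝ) ∞ F) (p : RegularSlab h) :
    IsMCriticalPt (𝓡∂ (n + 1)) (F ∘ incl h) p ↔ IsMCriticalPt (𝓡∂ (n + 1)) F (incl h p) := by
  have hfn : ContMDiff (𝓡∂ (n + 1)) 𝓘(ℝ, ℝ) ∞ (F ∘ incl h) := hF.comp (contMDiff_incl h hn)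
  have hFΘ : ContDiffOn ℝ ∞ (F ∘ (h.atlas.datum p).Θ.symm) (h.atlas.datum p).Θ.target :=
    contMDiffOn_iff_contDiffOn.1 (hF.comp_contMDiffOn (h.atlas.datum p).contMDiffOn_symm)
  have hz₀ : (h.atlas.datum p).Θ p.1 ∈ (h.atlas.datum p).Θ.target :=
    (h.atlas.datum p).Θ.map_source (h.atlas.mem_source p)
  have hFΘd : DifferentiableAt ℝ (F ∘ (h.atlas.datum p).Θ.symm) ((h.atlas.datum p).Θ p.1) :=
    ((hFΘ _ hz₀).contDiffAt ((h.atlas.datum p).Θ.open_target.mem_nhds hz₀)).differentiableAt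
      (by simp)
  have key : mfderiv (𝓡∂ (n + 1)) 𝓘(ℝ, ℝ) (F ∘ incl h) p =
      fderiv ℝ (F ∘ (h.atlas.datum p).Θ.symm) ((h.atlas.datum p).Θ p.1) :=
    h.atlas.mfderiv_comp_val_eq F p (hfn.mdifferentiableAt (by simp)) hFΘd
  have e1 : IsMCriticalPt (𝓡∂ (n + 1)) (F ∘ incl h) p ↔
      fderiv ℝ (F ∘ (h.atlas.datum p).Θ.symm) ((h.atlas.datum p).Θ p.1) = 0 := by
    rw [IsMCriticalPt, key]
    exact Iff.rfl
  have e2 := isMCriticalPt_iff_fderiv_comp_symm_eq_zero (h.atlas.datum p).contMDiffOn_toFun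
      (h.atlas.datum p).contMDiffOn_symm (h.atlas.mem_source p) (hF.mdifferentiableAt (by simp))
  exact e1.trans e2.symm

/-- **The Hessian of the restriction at a point of the open slab is the ambient Hessian** (there
the half-slice chart is the extended chart of `W`). [cite: MilnorHCobordism1965, Lemma 2.9 (PDF p. 11)] -/
theorem mhessian_comp_incl_eq {F : c.W → ℝ} (p : RegularSlab h) (hp : g (incl h p) ∈ Ioo a b) :
    mhessian (𝓡∂ (n + 1)) (F ∘ incl h) p = mhessian (𝓡∂ (n + 1)) F (incl h p) := by
  have hD := atlas_datum_Θ_eq_of_mem_Ioo h p hp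
  have hint : (𝓡∂ (n + 1)).IsInteriorPoint (incl h p) := h.isInteriorPoint_of_mem p.2
  have h0 : 0 < (h.atlas.datum p).Θ p.1 0 := by
    rw [hD, sublevelChartLT_apply]
    rw [ModelWithCorners.IsInteriorPoint, interior_range_modelWithCornersEuclideanHalfSpace] at hint
    exact hint
  have hF' : (F ∘ (h.atlas.datum p).Θ.symm) =ᶠ[𝓝 ((h.atlas.datum p).Θ p.1)]
      fun z => writtenInExtChartAt (𝓡∂ (n + 1)) 𝓘(ℝ, ℝ) p.1 F z + 0 := by
    refine Filter.Eventually.of_forall fun z => ?_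
    rw [hD]
    simp [writtenInExtChartAt]
  have key : mhessian (𝓡∂ (n + 1)) (F ∘ incl h) p = (ContinuousLinearMap.coeLM ℝ).comp
      (fderivWithin ℝ (fderivWithin ℝ (writtenInExtChartAt (𝓡∂ (n + 1)) 𝓘(ℝ, ℝ) p.1 F)
        (range (𝓡∂ (n + 1)))) (range (𝓡∂ (n + 1))) ((h.atlas.datum p).Θ p.1)).toLinearMap :=
    h.atlas.mhessian_comp_val_eq F p h0 hF'
  rw [key, mhessian, hD, sublevelChartLT_apply]
  rfl

/-- **The Morse index of the restriction at a point of the open slab is the ambient one.**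
[cite: MilnorHCobordism1965, Lemma 2.9 (PDF p. 11)] -/
theorem morseIndex_comp_incl_eq {F : c.W → ℝ} (p : RegularSlab h) (hp : g (incl h p) ∈ Ioo a b) :
    morseIndex (𝓡∂ (n + 1)) (F ∘ incl h) p = morseIndex (𝓡∂ (n + 1)) F (incl h p) := by
  rw [morseIndex, mhessian_comp_incl_eq h p hp, morseIndex]

end RegularSlab

end Transfer

end Literature.Topology.FourManifolds
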